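import Literature.Barriers.Schanuel.NesterenkoModularScopeSeriesProofs
import Mathlib.Analysis.Normed.Ring.InfiniteSum
import HarnessLib

/-!
# Barrier (Schanuel) `NesterenkoModularScope`: the formal composite `A(z, P, Q, R)` sums to its value on the unit disc — proofs only

`Literature/Barriers/Schanuel/NesterenkoModularScopeAnalytic.lean` — sibling proofs file of
`NesterenkoModularScopeSeries.lean`. No new definitions; proofs only. First step of the ANALYTIC
half of LNM 1752 Ch. 3 Lemma 3.4: the formal series `ramanujanComposite A ∈ ℂ⟦z⟧` (whose order and
coefficients `bₙ` carry Lemma 3.1, Theorem 2.3 and the polynomials `B_T`) is the Taylor series of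
the holomorphic function `F(z) = A(z, P(z), Q(z), R(z))` on `|z| < 1`:

* `hasSum_ramanujanComposite`: for `A ∈ ℂ[z, x₁, x₂, x₃]` and `‖z‖ < 1`,
  `∑ₙ bₙ zⁿ = A(z, P(z), Q(z), R(z))` (`= MvPolynomial.aeval (ramanujanPoint z) A`), the series
  converging absolutely — by induction on `A`, the generators being `hasSum_ramanujanP/Q/RSeries`
  and products being Cauchy products of absolutely convergent series
  (`tsum_mul_tsum_eq_tsum_sum_antidiagonal_of_summable_norm`);
* `hasSum_ramanujanComposite_int`: the same for `A ∈ ℤ[z, x₁, x₂, x₃]` (integer Taylor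
  coefficients `bₙ`, Ch. 3 §3 proof of Lemma 3.2).

## References

* [NesterenkoPhilippon2001] LNM 1752 (2001), Ch. 3 §1 (p. 27), §3 Lemmas 3.1–3.2 (pp. 34–35).
-/

noncomputable section

open Complex MvPolynomial Filter Topology Finset
open Literature.NumberTheory.Transcendental

namespace Literature.Barriers.Schanuel

/-! ### Absolute convergence from polynomial coefficient bounds -/

/-- If `‖aₙ‖ ≤ C (n+1)^k` then `∑ ‖aₙ zⁿ‖ < ∞` for `‖z‖ < 1`. [folklore] -/
theorem summable_norm_mul_pow_of_le {a : ℕ → ℂ} {C : ℝ} {k : ℕ}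
    (h : ∀ n, ‖a n‖ ≤ C * ((n : ℝ) + 1) ^ k) {z : ℂ} (hz : ‖z‖ < 1) :
    Summable (fun n => ‖a n * z ^ n‖) := by
  have hC : 0 ≤ C := by
    have := (norm_nonneg _).trans (h 0)
    simpa using this
  have hr : ‖(‖z‖ : ℝ)‖ < 1 := by simpa using hz
  have hs : Summable fun n : ℕ => C * 2 ^ k * ((n : ℝ) ^ k * ‖z‖ ^ n) :=
    (summable_pow_mul_geometric_of_norm_lt_one k hr).mul_left _
  refine Summable.of_norm_bounded_eventually hs ?_
  rw [Nat.cofinite_eq_atTop]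
  filter_upwards [eventually_ge_atTop 1] with n hn
  rw [norm_norm, norm_mul, norm_pow]
  have h1 : ((n : ℝ) + 1) ^ k ≤ 2 ^ k * (n : ℝ) ^ k := by
    rw [← mul_pow]
    exact pow_le_pow_left₀ (by positivity) (by
      have : (1 : ℝ) ≤ n := by exact_mod_cast hn
      linarith) k
  calc ‖a n‖ * ‖z‖ ^ n ≤ C * ((n : ℝ) + 1) ^ k * ‖z‖ ^ n :=
        mul_le_mul_of_nonneg_right (h n) (by positivity)
    _ ≤ C * (2 ^ k * (n : ℝ) ^ k) * ‖z‖ ^ n := by gcongr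
    _ = C * 2 ^ k * ((n : ℝ) ^ k * ‖z‖ ^ n) := by ring

/-! ### The four generators `z, P, Q, R` -/

/-- `‖σ_k(n)‖ ≤ (n+1)^{k+1}` as complex numbers. [folklore] -/
theorem norm_sigma_le (k n : ℕ) :
    ‖((ArithmeticFunction.sigma k n : ℕ) : ℂ)‖ ≤ ((n : ℝ) + 1) ^ (k + 1) := by
  rw [Complex.norm_natCast]
  have h1 : (ArithmeticFunction.sigma k n : ℝ) ≤ (n : ℝ) ^ (k + 1) := by
    exact_mod_cast ArithmeticFunction.sigma_le_pow_succ k n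
  exact h1.trans (pow_le_pow_left₀ (Nat.cast_nonneg n) (by linarith) _)

/-- The Taylor coefficients of the four generators `z, P, Q, R` are `O((n+1)⁶)`:
`‖coeff‖ ≤ 505 (n+1)⁶`. [cite: NesterenkoPhilippon2001, Ch. 3 §3 proof of Lemma 3.1 (p. 34)] -/
theorem norm_coeff_generator_le (i : Fin 4) (n : ℕ) :
    ‖PowerSeries.coeff n ((![PowerSeries.X, ramanujanPSeries.map (Int.castRingHom ℂ),
      ramanujanQSeries.map (Int.castRingHom ℂ), ramanujanRSeries.map (Int.castRingHom ℂ)] :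
        Fin 4 → PowerSeries ℂ) i)‖ ≤ 505 * ((n : ℝ) + 1) ^ 6 := by
  have h1 : (1 : ℝ) ≤ ((n : ℝ) + 1) ^ 6 := one_le_pow₀ (by linarith [(Nat.cast_nonneg n : (0:ℝ) ≤ n)])
  have hind : ‖(if n = 0 then (1 : ℂ) else 0)‖ ≤ 1 := by split_ifs <;> simp
  have hσ : ∀ k, k ≤ 5 → ‖((ArithmeticFunction.sigma k n : ℕ) : ℂ)‖ ≤ ((n : ℝ) + 1) ^ 6 := by
    intro k hk
    refine (norm_sigma_le k n).trans (pow_le_pow_right₀ (by linarith [(Nat.cast_nonneg n : (0:ℝ) ≤ n)]) (by omega))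
  fin_cases i
  · simp only [Fin.zero_eta, Matrix.cons_val_zero, PowerSeries.coeff_X]
    calc ‖(if n = 1 then (1 : ℂ) else 0)‖ ≤ 1 := by split_ifs <;> simp
      _ ≤ 505 * ((n : ℝ) + 1) ^ 6 := by linarith
  · simp only [Fin.mk_one, Matrix.cons_val_one, Matrix.cons_val_zero, PowerSeries.coeff_map,
      coeff_ramanujanPSeries, map_sub, map_mul, eq_intCast]
    push_cast
    refine (norm_sub_le _ _).trans ?_
    rw [norm_mul]
    have := hσ 1 (by norm_num)
    have h24 : ‖(24 : ℂ)‖ = 24 := by simp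
    rw [h24]
    nlinarith
  · simp only [Fin.reduceFinMk, Matrix.cons_val, PowerSeries.coeff_map, coeff_ramanujanQSeries,
      map_add, map_mul, eq_intCast]
    push_cast
    refine (norm_add_le _ _).trans ?_
    rw [norm_mul]
    have := hσ 3 (by norm_num)
    have h240 : ‖(240 : ℂ)‖ = 240 := by simp
    rw [h240]
    nlinarith
  · simp only [Fin.reduceFinMk, Matrix.cons_val, PowerSeries.coeff_map, coeff_ramanujanRSeries,
      map_sub, map_mul, eq_intCast]
    push_cast
    refine (norm_sub_le _ _).trans ?_
    rw [norm_mul]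
    have := hσ 5 (by norm_num)
    have h504 : ‖(504 : ℂ)‖ = 504 := by simp
    rw [h504]
    nlinarith

/-- The four generators sum to `z, P(z), Q(z), R(z)` on `‖z‖ < 1`.
[cite: NesterenkoPhilippon2001, Ch. 3 §1 (p. 27)] -/
theorem hasSum_generator (i : Fin 4) {z : ℂ} (hz : ‖z‖ < 1) :
    HasSum (fun n => PowerSeries.coeff n ((![PowerSeries.X, ramanujanPSeries.map (Int.castRingHom ℂ),
      ramanujanQSeries.map (Int.castRingHom ℂ), ramanujanRSeries.map (Int.castRingHom ℂ)] :
        Fin 4 → PowerSeries ℂ) i) * z ^ n) (ramanujanPoint z i) := by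
  fin_cases i
  · simp only [Fin.zero_eta, Matrix.cons_val_zero, PowerSeries.coeff_X, ramanujanPoint]
    convert hasSum_ite_eq 1 z using 1
    funext n
    split_ifs with h <;> simp [h]
  · simp only [Fin.mk_one, Matrix.cons_val_one, Matrix.cons_val_zero, PowerSeries.coeff_map,
      eq_intCast, ramanujanPoint]
    exact hasSum_ramanujanPSeries hz
  · simp only [Fin.reduceFinMk, Matrix.cons_val, PowerSeries.coeff_map, eq_intCast, ramanujanPoint]
    exact hasSum_ramanujanQSeries hz
  · simp only [Fin.reduceFinMk, Matrix.cons_val, PowerSeries.coeff_map, eq_intCast, ramanujanPoint]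
    exact hasSum_ramanujanRSeries hz

/-! ### The composite sums to its value -/

/-- **`A(z, P, Q, R)` as a formal series sums (absolutely) to `A(z, P(z), Q(z), R(z))` for
`‖z‖ < 1`**, `A ∈ ℂ[z, x₁, x₂, x₃]`. [cite: NesterenkoPhilippon2001, Ch. 3 §3 Lemma 3.2 (p. 35)] -/
theorem hasSum_ramanujanComposite (A : MvPolynomial (Fin 4) ℂ) {z : ℂ} (hz : ‖z‖ < 1) :
    Summable (fun n => ‖PowerSeries.coeff n (ramanujanComposite A) * z ^ n‖) ∧
    HasSum (fun n => PowerSeries.coeff n (ramanujanComposite A) * z ^ n)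
      (MvPolynomial.aeval (ramanujanPoint z) A) := by
  set v : Fin 4 → PowerSeries ℂ := ![PowerSeries.X, ramanujanPSeries.map (Int.castRingHom ℂ),
      ramanujanQSeries.map (Int.castRingHom ℂ), ramanujanRSeries.map (Int.castRingHom ℂ)] with hv
  have hcomp : ∀ p : MvPolynomial (Fin 4) ℂ, ramanujanComposite p = MvPolynomial.aeval v p := by
    intro p; rfl
  induction A using MvPolynomial.induction_on with
  | C a =>
    have hc : ∀ n, PowerSeries.coeff n (ramanujanComposite (C a : MvPolynomial (Fin 4) ℂ)) =
        if n = 0 then a else 0 := by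
      intro n
      rw [hcomp, MvPolynomial.aeval_C, ← PowerSeries.C_eq_algebraMap, PowerSeries.coeff_C]
    simp only [hc, MvPolynomial.aeval_C, Algebra.algebraMap_self, RingHom.id_apply]
    constructor
    · refine summable_of_ne_finset_zero (s := {0}) fun n hn => ?_
      rw [Finset.mem_singleton] at hn
      simp [hn]
    · convert hasSum_ite_eq 0 a using 1
      funext n
      split_ifs with h <;> simp [h]
  | add p q hp hq =>
    have hc : ∀ n, PowerSeries.coeff n (ramanujanComposite (p + q)) =
        PowerSeries.coeff n (ramanujanComposite p) + PowerSeries.coeff n (ramanujanComposite q) := by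
      intro n; rw [hcomp, map_add, map_add, ← hcomp, ← hcomp]
    simp only [hc, add_mul, map_add]
    exact ⟨Summable.of_norm_bounded (hp.1.add hq.1) fun n => by
      simpa only [norm_norm] using norm_add_le _ _, hp.2.add hq.2⟩
  | mul_X p i hp =>
    -- Cauchy product with the generator `v i`
    have hc : ∀ n, PowerSeries.coeff n (ramanujanComposite (p * X i)) =
        ∑ kl ∈ antidiagonal n, PowerSeries.coeff kl.1 (ramanujanComposite p) *
          PowerSeries.coeff kl.2 (v i) := by
      intro n; rw [hcomp, map_mul, MvPolynomial.aeval_X, ← hcomp, PowerSeries.coeff_mul]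
    have hG1 : Summable fun n => ‖PowerSeries.coeff n (v i) * z ^ n‖ :=
      summable_norm_mul_pow_of_le (norm_coeff_generator_le i) hz
    have hG2 : HasSum (fun n => PowerSeries.coeff n (v i) * z ^ n) (ramanujanPoint z i) :=
      hasSum_generator i hz
    have hprod : ∀ n, (∑ kl ∈ antidiagonal n, PowerSeries.coeff kl.1 (ramanujanComposite p) * z ^ kl.1 *
        (PowerSeries.coeff kl.2 (v i) * z ^ kl.2)) =
        PowerSeries.coeff n (ramanujanComposite (p * X i)) * z ^ n := by
      intro n
      rw [hc, Finset.sum_mul]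
      refine Finset.sum_congr rfl fun kl hkl => ?_
      rw [HasAntidiagonal.mem_antidiagonal] at hkl
      rw [← hkl, pow_add]; ring
    constructor
    · have hs := summable_norm_sum_mul_antidiagonal_of_summable_norm hp.1 hG1
      simpa only [hprod] using hs
    · have hs := summable_norm_sum_mul_antidiagonal_of_summable_norm hp.1 hG1
      have hsum : Summable fun n => PowerSeries.coeff n (ramanujanComposite (p * X i)) * z ^ n := by
        simpa only [hprod] using hs.of_norm
      have htsum := tsum_mul_tsum_eq_tsum_sum_antidiagonal_of_summable_norm hp.1 hG1
      simp only [hprod] at htsum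
      rw [hp.2.tsum_eq, hG2.tsum_eq] at htsum
      rw [map_mul, MvPolynomial.aeval_X, htsum]
      exact hsum.hasSum

/-- The same for `A ∈ ℤ[z, x₁, x₂, x₃]`: the integer Taylor coefficients `bₙ` of
`F = A(z, P, Q, R)` sum to `F(z)` for `‖z‖ < 1`. [cite: NesterenkoPhilippon2001, Ch. 3 §3 Lemma 3.2 (p. 35)] -/
theorem hasSum_ramanujanComposite_int (A : MvPolynomial (Fin 4) ℤ) {z : ℂ} (hz : ‖z‖ < 1) :
    Summable (fun n => ‖((PowerSeries.coeff n (ramanujanComposite A) : ℤ) : ℂ) * z ^ n‖) ∧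
    HasSum (fun n => ((PowerSeries.coeff n (ramanujanComposite A) : ℤ) : ℂ) * z ^ n)
      (MvPolynomial.aeval (ramanujanPoint z) A) := by
  have h := hasSum_ramanujanComposite (MvPolynomial.map (Int.castRingHom ℂ) A) hz
  rw [ramanujanComposite_map] at h
  simp only [PowerSeries.coeff_map, eq_intCast] at h
  rwa [← algebraMap_int_eq, MvPolynomial.aeval_map_algebraMap] at h

end Literature.Barriers.Schanuel

end
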